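import Mathlib
import Summits.Ventures.PercRepro2.CoinKSureAD
import Summits.Ventures.PercRepro2.CoinChainWorld1
import Summits.Ventures.PercRepro2.CoinChainMixLsm
import Summits.Ventures.PercRepro2.CoinChainXACross

/-!
# (XA′) for the GENERAL AND-switch chain when all six killed shifts are nonpositive
(blind cell PercRepro2, night-2 g26; proofs/NIGHT2-DARC.md §67.4)

Notation of `chain_XA'_of_signs`: `a, b, e, g` the moments of `R⁰, R¹, G⁰, G¹`.  If the six
world-0-centred shifts of the killed laws `Q = R⁰ − R¹`, `P⁰ = R⁰ − G⁰`, `P′ = (R¹ − G¹) − P⁰` are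
all NONPOSITIVE (the coin and both gates RAISE both marker means), then the killed-law shift
`K = Q + P′ + P⁰` has `K_x K_y ≥ Q_x P⁰_y + Q_y P⁰_x` (all nine products are nonnegative) and the
FKG inequality for the log-supermodular world-1 gate `G¹` gives `a0·U001 ≥ (a0/g0)·K_x K_y ≥ K_x K_y`
(cleared: `U001 = ∑ G¹ (a0x − a1)(a0y − a2)`, `∑ G¹(a0x − a1) = −K̃_x`): (XA′) holds
(`chain_XA'_of_negative_signs`), hence the chain at every `ρ` (`chain_functional_nonneg_of_negative_signs`).
-/

namespace Summit.Ventures.PercRepro2.Coin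

open Classical

section XANegAlg

variable {R : Type*} [Field R] [LinearOrder R] [IsStrictOrderedRing R]

/-- The product of the two cleared killed-law shifts is nonnegative when all six killed shifts
are nonpositive (each factor is a sum of three nonnegative pieces). -/
theorem xa_negsigns_KK (a0 a1 a2 b0 b1 b2 e0 e1 e2 g0 g1 g2 : R)
    (hqx : a1 * b0 ≤ a0 * b1) (hp0x : a1 * e0 ≤ a0 * e1)
    (hp'x : (a0 * b1 - a1 * b0) - (a0 * g1 - a1 * g0) + (a0 * e1 - a1 * e0) ≤ 0)
    (hqy : a2 * b0 ≤ a0 * b2) (hp0y : a2 * e0 ≤ a0 * e2)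
    (hp'y : (a0 * b2 - a2 * b0) - (a0 * g2 - a2 * g0) + (a0 * e2 - a2 * e0) ≤ 0) :
    0 ≤ (a0 * g1 - a1 * g0) * (a0 * g2 - a2 * g0) :=
  mul_nonneg (by linarith) (by linarith)

/-- The algebra: with `K̃_x = a0 g1 − a1 g0 ≥ 0`, `K̃_y ≥ 0` each a sum of three nonnegative
shifts, the FKG bound `g0·U001 ≥ K̃_x K̃_y`, `U001 ≥ 0` and `a0 ≥ g0`: `Cross ≤ a0·U001`. -/
theorem xa_negsigns_alg (a0 a1 a2 b0 b1 b2 e0 e1 e2 g0 g1 g2 g12 : R)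
    (hga : g0 ≤ a0)
    (hU : 0 ≤ a0 * a0 * g12 - a0 * a2 * g1 - a0 * a1 * g2 + a1 * a2 * g0)
    (hfkg : (a0 * g1 - a1 * g0) * (a0 * g2 - a2 * g0) ≤
      g0 * (a0 * a0 * g12 - a0 * a2 * g1 - a0 * a1 * g2 + a1 * a2 * g0))
    (hqx : a1 * b0 ≤ a0 * b1) (hp0x : a1 * e0 ≤ a0 * e1)
    (hp'x : (a0 * b1 - a1 * b0) - (a0 * g1 - a1 * g0) + (a0 * e1 - a1 * e0) ≤ 0)
    (hqy : a2 * b0 ≤ a0 * b2) (hp0y : a2 * e0 ≤ a0 * e2)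
    (hp'y : (a0 * b2 - a2 * b0) - (a0 * g2 - a2 * g0) + (a0 * e2 - a2 * e0) ≤ 0) :
    (a0 * b1 - a1 * b0) * (a0 * e2 - a2 * e0) + (a0 * b2 - a2 * b0) * (a0 * e1 - a1 * e0) ≤
      a0 * (a0 * a0 * g12 - a0 * a2 * g1 - a0 * a1 * g2 + a1 * a2 * g0) := by
  have hx1 : 0 ≤ a0 * b1 - a1 * b0 := by linarith
  have hx2 : 0 ≤ a0 * e1 - a1 * e0 := by linarith
  have hx3 : 0 ≤ (a0 * g1 - a1 * g0) - (a0 * b1 - a1 * b0) - (a0 * e1 - a1 * e0) := by linarith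
  have hy1 : 0 ≤ a0 * b2 - a2 * b0 := by linarith
  have hy2 : 0 ≤ a0 * e2 - a2 * e0 := by linarith
  have hy3 : 0 ≤ (a0 * g2 - a2 * g0) - (a0 * b2 - a2 * b0) - (a0 * e2 - a2 * e0) := by linarith
  -- `Cross ≤ K̃_x K̃_y` (all nine products nonnegative)
  have hcross : (a0 * b1 - a1 * b0) * (a0 * e2 - a2 * e0) + (a0 * b2 - a2 * b0) * (a0 * e1 - a1 * e0) ≤
      (a0 * g1 - a1 * g0) * (a0 * g2 - a2 * g0) := by
    nlinarith [mul_nonneg hx1 hy1, mul_nonneg hx2 hy2, mul_nonneg hx1 hy3, mul_nonneg hx3 hy1,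
      mul_nonneg hx2 hy3, mul_nonneg hx3 hy2, mul_nonneg hx3 hy3]
  have h2 : g0 * (a0 * a0 * g12 - a0 * a2 * g1 - a0 * a1 * g2 + a1 * a2 * g0) ≤
      a0 * (a0 * a0 * g12 - a0 * a2 * g1 - a0 * a1 * g2 + a1 * a2 * g0) :=
    mul_le_mul_of_nonneg_right hga hU
  linarith [hcross, hfkg, h2]

end XANegAlg

section XANegPointwise

variable {V : Type*} [DecidableEq V] {R : Type*} [Field R] [LinearOrder R]

/-- The world-1 gate is pointwise below the world-0 coin-open law (`d' ≤ d`, `d' ≤ c`). -/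
lemma chainMix_one_d'_le_zero_d (ent ent' : Finset V) {c d d' : Finset V → R}
    (hd'c : ∀ W, d' W ≤ c W) (hd'd : ∀ W, d' W ≤ d W) (W : Finset V) :
    chainMix ent ent' 1 c d' W ≤ chainMix ent ent' 0 c d W := by
  unfold chainMix chainTheta
  by_cases h0 : ∃ r ∈ ent, r ∈ W
  · simp [h0, hd'd W]
  · by_cases h1 : ∃ r ∈ ent', r ∈ W
    · simp [h0, h1, hd'c W]
    · simp [h0, h1]

end XANegPointwise

section XANegChain

variable {V : Type*} [DecidableEq V] {R : Type*} [Field R] [LinearOrder R] [IsStrictOrderedRing R]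

/-- **(XA′) FOR THE GENERAL AND-SWITCH CHAIN WHEN ALL SIX KILLED SHIFTS ARE NONPOSITIVE**
(the coin, the world-0 gate and the `D′`-pivotal part all RAISE both marker means; `hQxn`, `hP0xn`,
`hP'xn` and their `y`-versions are the reversed sign conditions of `chain_XA'_of_signs`): the FKG
inequality for the world-1 gate `G¹` gives `a0·U001 ≥ (a0/g0)·K̃_x K̃_y ≥ K̃_x K̃_y ≥ Cross`. -/
theorem chain_XA'_of_negative_signs (U ent ent' : Finset V) (ν c d d' : Finset V → R)
    (hν0 : ∀ W, 0 ≤ ν W)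
    (hν : ∀ s ⊆ U, ∀ t ⊆ U, ν s * ν t ≤ ν (s ∩ t) * ν (s ∪ t))
    (hc0 : ∀ W, 0 ≤ c W) (hd0 : ∀ W, 0 ≤ d W) (hd'0 : ∀ W, 0 ≤ d' W)
    (hd'c : ∀ W, d' W ≤ c W) (hd'd : ∀ W, d' W ≤ d W)
    (hcc : ∀ s t, c s * c t ≤ c (s ∩ t) * c (s ∪ t))
    (hd'd' : ∀ s t, d' s * d' t ≤ d' (s ∩ t) * d' (s ∪ t))
    (hcd' : ∀ s t, c s * d' t ≤ c (s ∩ t) * d' (s ∪ t))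
    (hratio' : ∀ s t, s ⊆ t → d' s * c t ≤ c s * d' t)
    (x y : Finset V → R) (hx0 : ∀ W, 0 ≤ x W) (hy0 : ∀ W, 0 ≤ y W)
    (hxm : ∀ s t, x s ≤ x (s ∪ t)) (hym : ∀ s t, y s ≤ y (s ∪ t))
    (hQxn : (∑ W ∈ U.powerset, ν W * chainMix ent ent' 0 c d W * x W) *
        (∑ W ∈ U.powerset, ν W * chainMix ent ent' 1 c d W) ≤
      (∑ W ∈ U.powerset, ν W * chainMix ent ent' 0 c d W) *
        (∑ W ∈ U.powerset, ν W * chainMix ent ent' 1 c d W * x W))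
    (hP0xn : (∑ W ∈ U.powerset, ν W * chainMix ent ent' 0 c d W * x W) *
        (∑ W ∈ U.powerset, ν W * chainMix ent ent' 0 c d' W) ≤
      (∑ W ∈ U.powerset, ν W * chainMix ent ent' 0 c d W) *
        (∑ W ∈ U.powerset, ν W * chainMix ent ent' 0 c d' W * x W))
    (hP'xn : ((∑ W ∈ U.powerset, ν W * chainMix ent ent' 0 c d W) *
          (∑ W ∈ U.powerset, ν W * chainMix ent ent' 1 c d W * x W)
        - (∑ W ∈ U.powerset, ν W * chainMix ent ent' 0 c d W * x W) *
          (∑ W ∈ U.powerset, ν W * chainMix ent ent' 1 c d W))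
      - ((∑ W ∈ U.powerset, ν W * chainMix ent ent' 0 c d W) *
          (∑ W ∈ U.powerset, ν W * chainMix ent ent' 1 c d' W * x W)
        - (∑ W ∈ U.powerset, ν W * chainMix ent ent' 0 c d W * x W) *
          (∑ W ∈ U.powerset, ν W * chainMix ent ent' 1 c d' W))
      + ((∑ W ∈ U.powerset, ν W * chainMix ent ent' 0 c d W) *
          (∑ W ∈ U.powerset, ν W * chainMix ent ent' 0 c d' W * x W)
        - (∑ W ∈ U.powerset, ν W * chainMix ent ent' 0 c d W * x W) *
          (∑ W ∈ U.powerset, ν W * chainMix ent ent' 0 c d' W)) ≤ 0)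
    (hQyn : (∑ W ∈ U.powerset, ν W * chainMix ent ent' 0 c d W * y W) *
        (∑ W ∈ U.powerset, ν W * chainMix ent ent' 1 c d W) ≤
      (∑ W ∈ U.powerset, ν W * chainMix ent ent' 0 c d W) *
        (∑ W ∈ U.powerset, ν W * chainMix ent ent' 1 c d W * y W))
    (hP0yn : (∑ W ∈ U.powerset, ν W * chainMix ent ent' 0 c d W * y W) *
        (∑ W ∈ U.powerset, ν W * chainMix ent ent' 0 c d' W) ≤
      (∑ W ∈ U.powerset, ν W * chainMix ent ent' 0 c d W) *
        (∑ W ∈ U.powerset, ν W * chainMix ent ent' 0 c d' W * y W))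
    (hP'yn : ((∑ W ∈ U.powerset, ν W * chainMix ent ent' 0 c d W) *
          (∑ W ∈ U.powerset, ν W * chainMix ent ent' 1 c d W * y W)
        - (∑ W ∈ U.powerset, ν W * chainMix ent ent' 0 c d W * y W) *
          (∑ W ∈ U.powerset, ν W * chainMix ent ent' 1 c d W))
      - ((∑ W ∈ U.powerset, ν W * chainMix ent ent' 0 c d W) *
          (∑ W ∈ U.powerset, ν W * chainMix ent ent' 1 c d' W * y W)
        - (∑ W ∈ U.powerset, ν W * chainMix ent ent' 0 c d W * y W) *
          (∑ W ∈ U.powerset, ν W * chainMix ent ent' 1 c d' W))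
      + ((∑ W ∈ U.powerset, ν W * chainMix ent ent' 0 c d W) *
          (∑ W ∈ U.powerset, ν W * chainMix ent ent' 0 c d' W * y W)
        - (∑ W ∈ U.powerset, ν W * chainMix ent ent' 0 c d W * y W) *
          (∑ W ∈ U.powerset, ν W * chainMix ent ent' 0 c d' W)) ≤ 0)
    :
    (((∑ W ∈ U.powerset, ν W * chainMix ent ent' 0 c d W) * (∑ W ∈ U.powerset, ν W * chainMix ent ent' 1 c d W * x W) - (∑ W ∈ U.powerset, ν W * chainMix ent ent' 0 c d W * x W) * (∑ W ∈ U.powerset, ν W * chainMix ent ent' 1 c d W)) *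
          ((∑ W ∈ U.powerset, ν W * chainMix ent ent' 0 c d W) * (∑ W ∈ U.powerset, ν W * chainMix ent ent' 0 c d' W * y W) - (∑ W ∈ U.powerset, ν W * chainMix ent ent' 0 c d W * y W) * (∑ W ∈ U.powerset, ν W * chainMix ent ent' 0 c d' W))
        + ((∑ W ∈ U.powerset, ν W * chainMix ent ent' 0 c d W) * (∑ W ∈ U.powerset, ν W * chainMix ent ent' 1 c d W * y W) - (∑ W ∈ U.powerset, ν W * chainMix ent ent' 0 c d W * y W) * (∑ W ∈ U.powerset, ν W * chainMix ent ent' 1 c d W)) *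
          ((∑ W ∈ U.powerset, ν W * chainMix ent ent' 0 c d W) * (∑ W ∈ U.powerset, ν W * chainMix ent ent' 0 c d' W * x W) - (∑ W ∈ U.powerset, ν W * chainMix ent ent' 0 c d W * x W) * (∑ W ∈ U.powerset, ν W * chainMix ent ent' 0 c d' W))) ≤
        (∑ W ∈ U.powerset, ν W * chainMix ent ent' 0 c d W) * ((∑ W ∈ U.powerset, ν W * chainMix ent ent' 0 c d W) * (∑ W ∈ U.powerset, ν W * chainMix ent ent' 0 c d W) * (∑ W ∈ U.powerset, ν W * chainMix ent ent' 1 c d' W * (x W * y W))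
          - (∑ W ∈ U.powerset, ν W * chainMix ent ent' 0 c d W) * (∑ W ∈ U.powerset, ν W * chainMix ent ent' 0 c d W * y W) * (∑ W ∈ U.powerset, ν W * chainMix ent ent' 1 c d' W * x W)
          - (∑ W ∈ U.powerset, ν W * chainMix ent ent' 0 c d W) * (∑ W ∈ U.powerset, ν W * chainMix ent ent' 0 c d W * x W) * (∑ W ∈ U.powerset, ν W * chainMix ent ent' 1 c d' W * y W)
          + (∑ W ∈ U.powerset, ν W * chainMix ent ent' 0 c d W * x W) * (∑ W ∈ U.powerset, ν W * chainMix ent ent' 0 c d W * y W) * (∑ W ∈ U.powerset, ν W * chainMix ent ent' 1 c d' W)) := by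
  have hm0 : ∀ W, 0 ≤ chainMix ent ent' 0 c d W := chainMix_nonneg ent ent' le_rfl zero_le_one hc0 hd0
  have hm1' : ∀ W, 0 ≤ chainMix ent ent' 1 c d' W :=
    chainMix_nonneg ent ent' zero_le_one le_rfl hc0 hd'0
  have hR0_0 : ∀ W, 0 ≤ ν W * chainMix ent ent' 0 c d W := fun W => mul_nonneg (hν0 W) (hm0 W)
  have hG1_0 : ∀ W, 0 ≤ ν W * chainMix ent ent' 1 c d' W := fun W => mul_nonneg (hν0 W) (hm1' W)
  have hmix' := mixture_lsm ent ent' 1 zero_le_one le_rfl c d' hc0 hd'0 hd'c hcc hd'd' hcd' hratio'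
  -- FKG for the world-1 gate
  have hfkg0 : (∑ W ∈ U.powerset, ν W * chainMix ent ent' 1 c d' W * x W) *
      (∑ W ∈ U.powerset, ν W * chainMix ent ent' 1 c d' W * y W) ≤
      (∑ W ∈ U.powerset, ν W * chainMix ent ent' 1 c d' W) *
      (∑ W ∈ U.powerset, ν W * chainMix ent ent' 1 c d' W * (x W * y W)) := by
    refine ad_pointwise U _ _ _ _ (fun W => mul_nonneg (hG1_0 W) (hx0 W))
      (fun W => mul_nonneg (hG1_0 W) (hy0 W)) hG1_0
      (fun W => mul_nonneg (hG1_0 W) (mul_nonneg (hx0 W) (hy0 W))) ?_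
    intro s hs t ht
    have hxs : x s ≤ x (s ∪ t) := hxm s t
    have hyt : y t ≤ y (s ∪ t) := by rw [Finset.union_comm]; exact hym t s
    have hlsm : ν s * chainMix ent ent' 1 c d' s * (ν t * chainMix ent ent' 1 c d' t) ≤
        ν (s ∩ t) * chainMix ent ent' 1 c d' (s ∩ t) * (ν (s ∪ t) * chainMix ent ent' 1 c d' (s ∪ t)) := by
      calc ν s * chainMix ent ent' 1 c d' s * (ν t * chainMix ent ent' 1 c d' t)
          = (ν s * ν t) * (chainMix ent ent' 1 c d' s * chainMix ent ent' 1 c d' t) := by ring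
        _ ≤ (ν (s ∩ t) * ν (s ∪ t)) *
              (chainMix ent ent' 1 c d' (s ∩ t) * chainMix ent ent' 1 c d' (s ∪ t)) :=
            mul_le_mul (hν s hs t ht) (hmix' s t) (mul_nonneg (hm1' _) (hm1' _))
              (mul_nonneg (hν0 _) (hν0 _))
        _ = _ := by ring
    calc ν s * chainMix ent ent' 1 c d' s * x s * (ν t * chainMix ent ent' 1 c d' t * y t)
        = (ν s * chainMix ent ent' 1 c d' s * (ν t * chainMix ent ent' 1 c d' t)) * (x s * y t) := by
          ring
      _ ≤ (ν (s ∩ t) * chainMix ent ent' 1 c d' (s ∩ t) * (ν (s ∪ t) * chainMix ent ent' 1 c d' (s ∪ t))) *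
            (x (s ∪ t) * y (s ∪ t)) :=
          mul_le_mul hlsm (mul_le_mul hxs hyt (hy0 t) (hx0 _)) (mul_nonneg (hx0 s) (hy0 t))
            (mul_nonneg (mul_nonneg (hν0 _) (hm1' _)) (mul_nonneg (hν0 _) (hm1' _)))
      _ = _ := by ring
  have hg0 : 0 ≤ ∑ W ∈ U.powerset, ν W * chainMix ent ent' 1 c d' W :=
    Finset.sum_nonneg fun W _ => hG1_0 W
  have hga : (∑ W ∈ U.powerset, ν W * chainMix ent ent' 1 c d' W) ≤
      ∑ W ∈ U.powerset, ν W * chainMix ent ent' 0 c d W :=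
    Finset.sum_le_sum fun W _ =>
      mul_le_mul_of_nonneg_left (chainMix_one_d'_le_zero_d ent ent' hd'c hd'd W) (hν0 W)
  have ha0 : 0 ≤ ∑ W ∈ U.powerset, ν W * chainMix ent ent' 0 c d W :=
    Finset.sum_nonneg fun W _ => hR0_0 W
  have hKK := xa_negsigns_KK _ _ _ _ _ _ _ _ _ _ _ _ hQxn hP0xn hP'xn hQyn hP0yn hP'yn
  -- the FKG bound in cleared form: `K̃_x K̃_y ≤ g0 · U001`
  have hfkg : ((∑ W ∈ U.powerset, ν W * chainMix ent ent' 0 c d W) *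
        (∑ W ∈ U.powerset, ν W * chainMix ent ent' 1 c d' W * x W) -
      (∑ W ∈ U.powerset, ν W * chainMix ent ent' 0 c d W * x W) *
        (∑ W ∈ U.powerset, ν W * chainMix ent ent' 1 c d' W)) *
      ((∑ W ∈ U.powerset, ν W * chainMix ent ent' 0 c d W) *
        (∑ W ∈ U.powerset, ν W * chainMix ent ent' 1 c d' W * y W) -
      (∑ W ∈ U.powerset, ν W * chainMix ent ent' 0 c d W * y W) *
        (∑ W ∈ U.powerset, ν W * chainMix ent ent' 1 c d' W)) ≤
      (∑ W ∈ U.powerset, ν W * chainMix ent ent' 1 c d' W) *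
      ((∑ W ∈ U.powerset, ν W * chainMix ent ent' 0 c d W) *
          (∑ W ∈ U.powerset, ν W * chainMix ent ent' 0 c d W) *
          (∑ W ∈ U.powerset, ν W * chainMix ent ent' 1 c d' W * (x W * y W))
        - (∑ W ∈ U.powerset, ν W * chainMix ent ent' 0 c d W) *
          (∑ W ∈ U.powerset, ν W * chainMix ent ent' 0 c d W * y W) *
          (∑ W ∈ U.powerset, ν W * chainMix ent ent' 1 c d' W * x W)
        - (∑ W ∈ U.powerset, ν W * chainMix ent ent' 0 c d W) *
          (∑ W ∈ U.powerset, ν W * chainMix ent ent' 0 c d W * x W) *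
          (∑ W ∈ U.powerset, ν W * chainMix ent ent' 1 c d' W * y W)
        + (∑ W ∈ U.powerset, ν W * chainMix ent ent' 0 c d W * x W) *
          (∑ W ∈ U.powerset, ν W * chainMix ent ent' 0 c d W * y W) *
          (∑ W ∈ U.powerset, ν W * chainMix ent ent' 1 c d' W)) := by
    nlinarith [mul_nonneg (mul_nonneg ha0 ha0) (sub_nonneg.2 hfkg0)]
  -- `U001 ≥ 0`: from the FKG bound when the gate has mass, trivially when it has none
  have hU : 0 ≤ (∑ W ∈ U.powerset, ν W * chainMix ent ent' 0 c d W) *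
          (∑ W ∈ U.powerset, ν W * chainMix ent ent' 0 c d W) *
          (∑ W ∈ U.powerset, ν W * chainMix ent ent' 1 c d' W * (x W * y W))
        - (∑ W ∈ U.powerset, ν W * chainMix ent ent' 0 c d W) *
          (∑ W ∈ U.powerset, ν W * chainMix ent ent' 0 c d W * y W) *
          (∑ W ∈ U.powerset, ν W * chainMix ent ent' 1 c d' W * x W)
        - (∑ W ∈ U.powerset, ν W * chainMix ent ent' 0 c d W) *
          (∑ W ∈ U.powerset, ν W * chainMix ent ent' 0 c d W * x W) *
          (∑ W ∈ U.powerset, ν W * chainMix ent ent' 1 c d' W * y W)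
        + (∑ W ∈ U.powerset, ν W * chainMix ent ent' 0 c d W * x W) *
          (∑ W ∈ U.powerset, ν W * chainMix ent ent' 0 c d W * y W) *
          (∑ W ∈ U.powerset, ν W * chainMix ent ent' 1 c d' W) := by
    rcases eq_or_lt_of_le hg0 with h0 | hpos
    · have hz : ∀ W ∈ U.powerset, ν W * chainMix ent ent' 1 c d' W = 0 :=
        (Finset.sum_eq_zero_iff_of_nonneg fun W _ => hG1_0 W).1 h0.symm
      have hz1 : (∑ W ∈ U.powerset, ν W * chainMix ent ent' 1 c d' W * x W) = 0 :=
        Finset.sum_eq_zero fun W hW => by rw [hz W hW, zero_mul]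
      have hz2 : (∑ W ∈ U.powerset, ν W * chainMix ent ent' 1 c d' W * y W) = 0 :=
        Finset.sum_eq_zero fun W hW => by rw [hz W hW, zero_mul]
      have hz12 : (∑ W ∈ U.powerset, ν W * chainMix ent ent' 1 c d' W * (x W * y W)) = 0 :=
        Finset.sum_eq_zero fun W hW => by rw [hz W hW, zero_mul]
      rw [hz1, hz2, hz12, ← h0]; ring_nf; exact le_rfl
    · nlinarith [hfkg, hKK, hpos]
  exact xa_negsigns_alg _ _ _ _ _ _ _ _ _ _ _ _ _ hga hU hfkg hQxn hP0xn hP'xn hQyn hP0yn hP'yn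

end XANegChain

section XANegChainRho

variable {V : Type*} [DecidableEq V] {R : Type*} [Field R] [LinearOrder R] [IsStrictOrderedRing R]

/-- **THE GENERAL AND-SWITCH CHAIN AT EVERY COIN PROBABILITY WHEN ALL SIX KILLED SHIFTS ARE
NONPOSITIVE** (`chain_functional_nonneg_of_XA'` with `hXA'` discharged by
`chain_XA'_of_negative_signs`). -/
theorem chain_functional_nonneg_of_negative_signs (U ent ent' : Finset V) (ν c d d' : Finset V → R)
    (ρ : R) (hρ0 : 0 ≤ ρ) (hρ1 : ρ ≤ 1) (hν0 : ∀ W, 0 ≤ ν W)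
    (hν : ∀ s ⊆ U, ∀ t ⊆ U, ν s * ν t ≤ ν (s ∩ t) * ν (s ∪ t))
    (hc0 : ∀ W, 0 ≤ c W) (hd0 : ∀ W, 0 ≤ d W) (hd'0 : ∀ W, 0 ≤ d' W)
    (hdc : ∀ W, d W ≤ c W) (hd'c : ∀ W, d' W ≤ c W) (hd'd : ∀ W, d' W ≤ d W)
    (hcc : ∀ s t, c s * c t ≤ c (s ∩ t) * c (s ∪ t))
    (hdd : ∀ s t, d s * d t ≤ d (s ∩ t) * d (s ∪ t))
    (hd'd' : ∀ s t, d' s * d' t ≤ d' (s ∩ t) * d' (s ∪ t))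
    (hcd : ∀ s t, c s * d t ≤ c (s ∩ t) * d (s ∪ t))
    (hcd' : ∀ s t, c s * d' t ≤ c (s ∩ t) * d' (s ∪ t))
    (hdd' : ∀ s t, d s * d' t ≤ d (s ∩ t) * d' (s ∪ t))
    (hratio : ∀ s t, s ⊆ t → d s * c t ≤ c s * d t)
    (hratio' : ∀ s t, s ⊆ t → d' s * c t ≤ c s * d' t)
    (x y : Finset V → R) (hx0 : ∀ W, 0 ≤ x W) (hy0 : ∀ W, 0 ≤ y W)
    (hxm : ∀ s t, x s ≤ x (s ∪ t)) (hym : ∀ s t, y s ≤ y (s ∪ t))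
    (hpos0 : 0 < ∑ W ∈ U.powerset, ν W * chainMix ent ent' 0 c d W)
    (hpos1 : 0 < ∑ W ∈ U.powerset, ν W * chainMix ent ent' 1 c d W)
    (hmI : 0 < ∑ W ∈ U.powerset.filter (fun W => ¬ ∃ r ∈ ent ∪ ent', r ∈ W), ν W * c W)
    (hQxn : (∑ W ∈ U.powerset, ν W * chainMix ent ent' 0 c d W * x W) *
        (∑ W ∈ U.powerset, ν W * chainMix ent ent' 1 c d W) ≤
      (∑ W ∈ U.powerset, ν W * chainMix ent ent' 0 c d W) *
        (∑ W ∈ U.powerset, ν W * chainMix ent ent' 1 c d W * x W))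
    (hP0xn : (∑ W ∈ U.powerset, ν W * chainMix ent ent' 0 c d W * x W) *
        (∑ W ∈ U.powerset, ν W * chainMix ent ent' 0 c d' W) ≤
      (∑ W ∈ U.powerset, ν W * chainMix ent ent' 0 c d W) *
        (∑ W ∈ U.powerset, ν W * chainMix ent ent' 0 c d' W * x W))
    (hP'xn : ((∑ W ∈ U.powerset, ν W * chainMix ent ent' 0 c d W) *
          (∑ W ∈ U.powerset, ν W * chainMix ent ent' 1 c d W * x W)
        - (∑ W ∈ U.powerset, ν W * chainMix ent ent' 0 c d W * x W) *
          (∑ W ∈ U.powerset, ν W * chainMix ent ent' 1 c d W))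
      - ((∑ W ∈ U.powerset, ν W * chainMix ent ent' 0 c d W) *
          (∑ W ∈ U.powerset, ν W * chainMix ent ent' 1 c d' W * x W)
        - (∑ W ∈ U.powerset, ν W * chainMix ent ent' 0 c d W * x W) *
          (∑ W ∈ U.powerset, ν W * chainMix ent ent' 1 c d' W))
      + ((∑ W ∈ U.powerset, ν W * chainMix ent ent' 0 c d W) *
          (∑ W ∈ U.powerset, ν W * chainMix ent ent' 0 c d' W * x W)
        - (∑ W ∈ U.powerset, ν W * chainMix ent ent' 0 c d W * x W) *
          (∑ W ∈ U.powerset, ν W * chainMix ent ent' 0 c d' W)) ≤ 0)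
    (hQyn : (∑ W ∈ U.powerset, ν W * chainMix ent ent' 0 c d W * y W) *
        (∑ W ∈ U.powerset, ν W * chainMix ent ent' 1 c d W) ≤
      (∑ W ∈ U.powerset, ν W * chainMix ent ent' 0 c d W) *
        (∑ W ∈ U.powerset, ν W * chainMix ent ent' 1 c d W * y W))
    (hP0yn : (∑ W ∈ U.powerset, ν W * chainMix ent ent' 0 c d W * y W) *
        (∑ W ∈ U.powerset, ν W * chainMix ent ent' 0 c d' W) ≤
      (∑ W ∈ U.powerset, ν W * chainMix ent ent' 0 c d W) *
        (∑ W ∈ U.powerset, ν W * chainMix ent ent' 0 c d' W * y W))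
    (hP'yn : ((∑ W ∈ U.powerset, ν W * chainMix ent ent' 0 c d W) *
          (∑ W ∈ U.powerset, ν W * chainMix ent ent' 1 c d W * y W)
        - (∑ W ∈ U.powerset, ν W * chainMix ent ent' 0 c d W * y W) *
          (∑ W ∈ U.powerset, ν W * chainMix ent ent' 1 c d W))
      - ((∑ W ∈ U.powerset, ν W * chainMix ent ent' 0 c d W) *
          (∑ W ∈ U.powerset, ν W * chainMix ent ent' 1 c d' W * y W)
        - (∑ W ∈ U.powerset, ν W * chainMix ent ent' 0 c d W * y W) *
          (∑ W ∈ U.powerset, ν W * chainMix ent ent' 1 c d' W))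
      + ((∑ W ∈ U.powerset, ν W * chainMix ent ent' 0 c d W) *
          (∑ W ∈ U.powerset, ν W * chainMix ent ent' 0 c d' W * y W)
        - (∑ W ∈ U.powerset, ν W * chainMix ent ent' 0 c d W * y W) *
          (∑ W ∈ U.powerset, ν W * chainMix ent ent' 0 c d' W)) ≤ 0)
    :
    0 ≤ (∑ W ∈ U.powerset, ν W * chainMix ent ent' ρ c d W) ^ 2 *
          (∑ W ∈ U.powerset, ν W * chainMix ent ent' ρ c d' W * (x W * y W))
        - (∑ W ∈ U.powerset, ν W * chainMix ent ent' ρ c d W) *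
          (∑ W ∈ U.powerset, ν W * chainMix ent ent' ρ c d W * x W) *
          (∑ W ∈ U.powerset, ν W * chainMix ent ent' ρ c d' W * y W)
        - (∑ W ∈ U.powerset, ν W * chainMix ent ent' ρ c d W) *
          (∑ W ∈ U.powerset, ν W * chainMix ent ent' ρ c d W * y W) *
          (∑ W ∈ U.powerset, ν W * chainMix ent ent' ρ c d' W * x W)
        + (∑ W ∈ U.powerset, ν W * chainMix ent ent' ρ c d W * x W) *
          (∑ W ∈ U.powerset, ν W * chainMix ent ent' ρ c d W * y W) *
          (∑ W ∈ U.powerset, ν W * chainMix ent ent' ρ c d' W) :=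
  chain_functional_nonneg_of_XA' U ent ent' ν c d d' ρ hρ0 hρ1 hν0 hν hc0 hd0 hd'0 hdc hd'c hd'd
    hcc hdd hd'd' hcd hcd' hdd' hratio hratio' x y hx0 hy0 hxm hym hpos0 hpos1 hmI
    (chain_XA'_of_negative_signs U ent ent' ν c d d' hν0 hν hc0 hd0 hd'0 hd'c hd'd hcc hd'd'
      hcd' hratio' x y hx0 hy0 hxm hym hQxn hP0xn hP'xn hQyn hP0yn hP'yn)

end XANegChainRho

end Summit.Ventures.PercRepro2.Coin
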